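import Summits.Ventures.PercRepro.K5ForestsBase

/-!
# PercRepro — the forests of `K₅`: the augmentation axiom, part 1 of 3 (p9, gen 15; local draft)

The members `I` of `forestsL1` against every forest `J`, decided in the kernel as three `Bool` computations (one per
part of `J`; `List.all` / `List.any` / `&&`, the witness checked against the circuits by `indepB`), then read back as
the `Prop` statement. Assembled into `aug_forests` in `K5Matroid`. Nothing here is about any window of S4.
-/

namespace PercRepro.K5Ladder

open Finset

set_option maxHeartbeats 20000000 in
/-- The augmentation axiom, the members `I` of part 1 against the forests of part 1, as ONE `Bool` computation
(`List.all` / `List.any` / `&&` — no nested `Decidable` structure for the kernel; the witness is checked against the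
circuits by `indepB`). -/
theorem augB_11 : (forestsL1.all fun I => forestsL1.all fun J =>
    !decide (I.card < J.card) || (List.finRange 10).any fun e =>
      decide (e ∈ J) && !decide (e ∈ I) && indepB (insert e I)) = true := by
  decide +kernel

set_option maxHeartbeats 20000000 in
/-- The augmentation axiom, the members `I` of part 1 against the forests of part 2, as ONE `Bool` computation
(`List.all` / `List.any` / `&&` — no nested `Decidable` structure for the kernel; the witness is checked against the
circuits by `indepB`). -/
theorem augB_12 : (forestsL1.all fun I => forestsL2.all fun J =>
    !decide (I.card < J.card) || (List.finRange 10).any fun e =>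
      decide (e ∈ J) && !decide (e ∈ I) && indepB (insert e I)) = true := by
  decide +kernel

set_option maxHeartbeats 20000000 in
/-- The augmentation axiom, the members `I` of part 1 against the forests of part 3, as ONE `Bool` computation
(`List.all` / `List.any` / `&&` — no nested `Decidable` structure for the kernel; the witness is checked against the
circuits by `indepB`). -/
theorem augB_13 : (forestsL1.all fun I => forestsL3.all fun J =>
    !decide (I.card < J.card) || (List.finRange 10).any fun e =>
      decide (e ∈ J) && !decide (e ∈ I) && indepB (insert e I)) = true := by
  decide +kernel

/-- The augmentation axiom, the members `I` of part 1 against every forest (from the `Bool` computations). -/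
theorem aug_forests_1 : ∀ I ∈ forestsL1, ∀ J ∈ forestsL, I.card < J.card →
    ∃ e ∈ J, e ∉ I ∧ indepF (insert e I) := by
  intro I hI J hJ hcard
  simp only [forestsL, List.mem_append] at hJ
  have key : ∀ (l : List (Finset (Fin 10))), (forestsL1.all fun I => l.all fun J =>
      !decide (I.card < J.card) || (List.finRange 10).any fun e =>
        decide (e ∈ J) && !decide (e ∈ I) && indepB (insert e I)) = true → J ∈ l →
      ∃ e ∈ J, e ∉ I ∧ indepF (insert e I) := by
    intro l hl hJl
    rw [List.all_eq_true] at hl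
    have h1 := hl I hI
    rw [List.all_eq_true] at h1
    have h2 := h1 J hJl
    rw [Bool.or_eq_true, Bool.not_eq_true', decide_eq_false_iff_not, List.any_eq_true] at h2
    rcases h2 with h2 | ⟨e, -, h3⟩
    · exact absurd hcard h2
    · rw [Bool.and_eq_true, Bool.and_eq_true, decide_eq_true_eq, Bool.not_eq_true', decide_eq_false_iff_not,
        indepB_eq_true] at h3
      exact ⟨e, h3.1.1, h3.1.2, h3.2⟩
  rcases hJ with (h1 | h2) | h3
  · exact key forestsL1 augB_11 h1
  · exact key forestsL2 augB_12 h2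
  · exact key forestsL3 augB_13 h3

end PercRepro.K5Ladder
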